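import Summits.Ventures.PercRepro2.CaseOneStarCertT1
import Summits.Ventures.PercRepro2.CaseOneGadgetUWA1BBlockII0
import Summits.Ventures.PercRepro2.CaseOneGadgetUWA1BBlockII1
import Summits.Ventures.PercRepro2.CaseOneGadgetUWA1BBlockII2
import Summits.Ventures.PercRepro2.CaseOneGadgetUWA1BBlockII3
import Summits.Ventures.PercRepro2.CaseOneGadgetUWA1BBlockII4
import Summits.Ventures.PercRepro2.CaseOneGadgetUWA1BBlockII5
import Summits.Ventures.PercRepro2.CaseOneGadgetUWA1BBlockII6
import Summits.Ventures.PercRepro2.CaseOneGadgetUWA1BBlockII7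
import Summits.Ventures.PercRepro2.CaseOneGadgetUWA1BBlockII8
import Summits.Ventures.PercRepro2.CaseOneGadgetUWA1BBlockII9
import Summits.Ventures.PercRepro2.CaseOneGadgetUWA1BBlockII10
import Summits.Ventures.PercRepro2.CaseOneGadgetUWA1BBlockII11
import Summits.Ventures.PercRepro2.CaseOneGadgetUWA1BBlockII12
import Summits.Ventures.PercRepro2.CaseOneGadgetUWA1BBlockII13
import Summits.Ventures.PercRepro2.CaseOneGadgetUWA1BBlockII14
import Summits.Ventures.PercRepro2.CaseOneStarFactsB

/-!
# The gadget `u ~ {w, a₁, b}`, `w ~ {u, a₂, o}` (uwa1b): the cell certificates of `iiAB5` (part 24b)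
(blind cell PercRepro2, p1 g34; the fourth gadget anchor of the six-form calculus — all six forms of the uwa1b gadget
as plain SFacts-cone certificate chains, generated by mining/p1/g34/uwa1b/genu.py = p1 g33's gent_uwa1.py / g25's
geno.py re-targeted; P1-G33 §6–§6″, P1-G34)

Each `eBABII ijk kl` is a nonnegative combination of `(pairwise atom) × (cell)` and cubic cell monomials — or, for the degree-4 ones, `M × eBABII ijk kl` (`M = Σ cᵢ` the total cell mass) is a nonnegative combination of `(atom) × (cell) × (cell)` and quartic cell monomials, then `SFacts.nonneg_of_sum_mul` (`CaseOneStarCertT1`) — exact LP certificates (kit j318477, every certificate re-verified exactly; data/p1/g33/gcerts_ii_uwa1b.json, form `ii`), here as exact `linear_combination`s over `SFacts` (the rational coefficients cleared by their common denominator). -/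

namespace Summit.Ventures.PercRepro2

namespace CaseOne

section CertABII24b
variable {R : Type*} [Field R] [LinearOrder R] [IsStrictOrderedRing R]

set_option maxHeartbeats 0 in
/-- `eBABII13311 ≥ 0`: the combination is identically zero (`ring`). -/
lemma eBABII13311_nonneg (m : SCells R) (_hf : SFactsB m) : 0 ≤ eBABII13311 m := by
  have h : eBABII13311 m = 0 := by
    unfold eBABII13311 cBABII00111 cBABII00211 cBABII01011 cBABII01111 cBABII01211 cBABII01311 cBABII02011 cBABII02111 cBABII02211 cBABII02311 cBABII03111 cBABII03211 cBABII03311 cBABII10011 cBABII10111 cBABII10211 cBABII10311 cBABII11011 cBABII11111 cBABII11211 cBABII11311 cBABII12011 cBABII12111 cBABII12211 cBABII12311 cBABII13011 cBABII13111 cBABII13211 cBABII13311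
    ring
  linarith [h]

set_option maxHeartbeats 0 in
/-- `eBABII13312 ≥ 0`: the combination is identically zero (`ring`). -/
lemma eBABII13312_nonneg (m : SCells R) (_hf : SFactsB m) : 0 ≤ eBABII13312 m := by
  have h : eBABII13312 m = 0 := by
    unfold eBABII13312 cBABII00112 cBABII00212 cBABII01012 cBABII01112 cBABII01212 cBABII01312 cBABII02012 cBABII02112 cBABII02212 cBABII02312 cBABII03112 cBABII03212 cBABII03312 cBABII10012 cBABII10112 cBABII10212 cBABII10312 cBABII11012 cBABII11112 cBABII11212 cBABII11312 cBABII12012 cBABII12112 cBABII12212 cBABII12312 cBABII13012 cBABII13112 cBABII13212 cBABII13312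
    ring
  linarith [h]

end CertABII24b

end CaseOne

end Summit.Ventures.PercRepro2
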